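import Literature.Analysis.FunctionSpaces.FractionalGagliardoSobolevInequality
import Literature.Analysis.FunctionSpaces.GagliardoSeminormLipschitzCutoff
import Mathlib.Analysis.SpecialFunctions.JapaneseBracket
import Mathlib.Analysis.SpecialFunctions.Pow.Integral
import HarnessLib

/-!
# Localised fractional Sobolev bound on `ℝ³` under scale-invariant decay
# (Di Nezza–Palatucci–Valdinoci 2012, Theorem 6.5 localised by Lemma 5.3 / Lemma 5.1)

Topic `Analysis/FunctionSpaces`. Theorems only: no definitions, no named facts, no `sorry`.

The corollary of Di Nezza–Palatucci–Valdinoci 2012 **Theorem 6.5** for `(n,s,p,p⋆) = (3,½,2,3)`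
(`FractionalGagliardoSobolevInequality.lean`) and of the cut-off **Lemma 5.3** together with the far-field
estimate of the proof of **Lemma 5.1** (`GagliardoSeminormLipschitzCutoff.lean`), for fields on `ℝ³` that need
not lie in `L²(ℝ³)` but obey the scale-invariant decay `‖x‖ ‖f x‖ ≤ D`:

* `exists_lintegral_ball_cube_le_of_decay_R3` — there is an absolute `C < ∞` such that for every `D` and every
  a.e.-strongly measurable `f : ℝ³ → F` with `‖x‖ ‖f(x)‖ ≤ D` for all `x`,
  `(∫_{B₁} ‖f‖³)^{2/3} ≤ C ∫_{x ∈ B₂} ∫_{y ∈ ℝ³} ‖f x − f y‖² / ‖x − y‖⁴ dy dx + C D²`;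
* `exists_lintegral_ball_cube_le_rpow_of_decay_R3` — the same with the power `2/3` moved to the right-hand side
  and the cube as a natural-number power (the shape used by slice-wise `L³(B₁)` bounds).

Proof (the printed localisation argument, `[cite: DinezzaPalatucciValdinoci2012, §5]`): apply Theorem 6.5 to
`ψ f` with the `1`-Lipschitz cut-off `ψ(x) = max(0, min(1, 2 − ‖x‖))` (`= 1` on `B₁`, `= 0` off `B₂`); split
`|ψf(x) − ψf(y)|² ≤ 2|ψ(x)|²|f(x)−f(y)|² + 2|f(y)|²|ψ(x)−ψ(y)|²` (Lemma 5.3); the first piece lives on `x ∈ B₂`;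
in the second, the weight `W(y) = ∫ |ψ(x)−ψ(y)|²/|x−y|⁴ dx` is bounded (Lemma 5.3) and `≲ |y|⁻⁴` for `|y| ≥ 4`
(proof of Lemma 5.1), so that `∫ |f(y)|² W(y) dy ≤ D² ∫ |y|⁻² W(y) dy = K D²` with
`K ≤ C_W ∫_{B₄} |y|⁻² + |B₂| ∫_{|y|≥4} 16|y|⁻⁶ < ∞` (Mathlib's `integrableOn_ball_of_norm_le_rpow`,
`finite_integral_one_add_norm`).  By scaling the same constant serves every pair `B_R ⊂ B_{2R}`; only the unit
case is recorded.

Motivation (consumer): the step «uniform windowed Gagliardo bound ⇒ `L³(B₁)` bound on slices» of the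
Navier–Stokes door lines (nsreg S20 B5a `stub_sobolevFatou` = S21-C F4), whose profiles satisfy
`‖v(t,x)‖ ≤ D/(‖x‖ + √(−t)) ≤ D/‖x‖`.
-/

open MeasureTheory Metric Set Filter
open scoped ENNReal NNReal Topology

namespace Literature.Analysis.FunctionSpaces

namespace DiNezzaPalatucciValdinoci2012

/-! ### The cut-off and two absorbing integrals -/

/-- A piecewise-linear radial cut-off (`ψ(x) = max(0, min(1, 2 − ‖x‖))`): values in `[0,1]`, `= 1` on `B₁`,
`= 0` off the open ball `B₂`, `1`-Lipschitz. [folklore] -/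
private theorem exists_cutoff {E : Type*} [SeminormedAddCommGroup E] :
    ∃ ψ : E → ℝ, (∀ x, 0 ≤ ψ x ∧ ψ x ≤ 1) ∧ (∀ x, ‖x‖ < 1 → ψ x = 1) ∧ (∀ x, 2 ≤ ‖x‖ → ψ x = 0) ∧
      LipschitzWith 1 ψ := by
  refine ⟨fun x => max 0 (min 1 (2 - ‖x‖)),
    fun x => ⟨le_max_left _ _, max_le zero_le_one (min_le_left _ _)⟩, fun x hx => ?_, fun x hx => ?_, ?_⟩
  · simp only
    rw [min_eq_left (by linarith), max_eq_right zero_le_one]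
  · simp only
    rw [max_eq_left]
    exact (min_le_right _ _).trans (by linarith)
  · refine LipschitzWith.of_dist_le_mul fun x y => ?_
    rw [Real.dist_eq, NNReal.coe_one, one_mul, dist_eq_norm]
    calc |max 0 (min 1 (2 - ‖x‖)) - max 0 (min 1 (2 - ‖y‖))|
        ≤ max |(0 : ℝ) - 0| |min 1 (2 - ‖x‖) - min 1 (2 - ‖y‖)| := abs_max_sub_max_le_max _ _ _ _
      _ = |min 1 (2 - ‖x‖) - min 1 (2 - ‖y‖)| := by
          rw [sub_self, abs_zero, max_eq_right (abs_nonneg _)]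
      _ ≤ max |(1 : ℝ) - 1| |(2 - ‖x‖) - (2 - ‖y‖)| := abs_min_sub_min_le_max _ _ _ _
      _ = |‖y‖ - ‖x‖| := by
          rw [sub_self, abs_zero, max_eq_right (abs_nonneg _)]; ring_nf
      _ ≤ ‖y - x‖ := abs_norm_sub_norm_le _ _
      _ = ‖x - y‖ := norm_sub_rev _ _

/-- For `t ≥ 4`: `t⁻² (t/2)⁻⁴ = 16 t⁻⁶ ≤ 1024 (1+t)⁻⁶` (since `1 + t ≤ 2t`). [folklore] -/
private theorem far_weight_real {t : ℝ} (ht : 4 ≤ t) :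
    t ^ (-(2 : ℝ)) * ((t / 2) ^ (4 : ℝ))⁻¹ ≤ 1024 * (1 + t) ^ (-(6 : ℝ)) := by
  have ht0 : 0 < t := by linarith
  have e2 : t ^ (-(2 : ℝ)) = (t ^ 2)⁻¹ := by rw [Real.rpow_neg ht0.le, Real.rpow_two]
  have e4 : (t / 2) ^ (4 : ℝ) = (t / 2) ^ 4 := by exact_mod_cast Real.rpow_natCast (t / 2) 4
  have e6 : (1 + t) ^ (-(6 : ℝ)) = ((1 + t) ^ 6)⁻¹ := by
    rw [Real.rpow_neg (by linarith)]
    exact_mod_cast congrArg (·⁻¹) (Real.rpow_natCast (1 + t) 6)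
  rw [e2, e4, e6, ← mul_inv, ← div_eq_mul_inv, inv_eq_one_div,
    div_le_div_iff₀ (by positivity) (by positivity), one_mul]
  calc (1 + t) ^ 6 ≤ (2 * t) ^ 6 := pow_le_pow_left₀ (by linarith) (by linarith) 6
    _ = 1024 * (t ^ 2 * (t / 2) ^ 4) := by ring

/-- `∫_{B_r} ‖y‖⁻² dy < ∞` in `ℝ³` (`2 < 3`). [folklore] -/
private theorem lintegral_ball_rpow_neg_two_lt_top (r : ℝ) :
    ∫⁻ y in ball (0 : EuclideanSpace ℝ (Fin 3)) r, ENNReal.ofReal (‖y‖ ^ (-(2 : ℝ))) < ⊤ := by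
  have hn3 : Module.finrank ℝ (EuclideanSpace ℝ (Fin 3)) = 3 := by simp
  have hint : IntegrableOn (fun y : EuclideanSpace ℝ (Fin 3) => ‖y‖ ^ (-(2 : ℝ))) (ball 0 r) volume := by
    refine integrableOn_ball_of_norm_le_rpow (by rw [hn3]; norm_num) (C := 1) (α := 2)
      (by rw [hn3]; norm_num) (ae_of_all _ fun y => ?_) ?_
    · rw [Real.norm_eq_abs, abs_of_nonneg (Real.rpow_nonneg (norm_nonneg _) _), one_mul]
    · exact (by fun_prop : Measurable fun y : EuclideanSpace ℝ (Fin 3) => ‖y‖ ^ (-(2 : ℝ))).aestronglyMeasurable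
  exact hint.lintegral_lt_top

/-- `∫_{‖y‖ ≥ 4} ‖y‖⁻² (‖y‖/2)⁻⁴ dy < ∞` in `ℝ³` (`6 > 3`). [folklore] -/
private theorem lintegral_far_weight_lt_top :
    ∫⁻ y in (ball (0 : EuclideanSpace ℝ (Fin 3)) 4)ᶜ,
      ENNReal.ofReal (‖y‖ ^ (-(2 : ℝ))) * (ENNReal.ofReal (‖y‖ / 2) ^ (4 : ℝ))⁻¹ < ⊤ := by
  have hn3 : Module.finrank ℝ (EuclideanSpace ℝ (Fin 3)) = 3 := by simp
  have hfin : ∫⁻ y : EuclideanSpace ℝ (Fin 3), ENNReal.ofReal ((1 + ‖y‖) ^ (-(6 : ℝ))) < ⊤ :=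
    finite_integral_one_add_norm (by rw [hn3]; norm_num)
  refine lt_of_le_of_lt ?_ (ENNReal.mul_lt_top (ENNReal.ofReal_lt_top (r := 1024)) hfin)
  calc ∫⁻ y in (ball (0 : EuclideanSpace ℝ (Fin 3)) 4)ᶜ,
        ENNReal.ofReal (‖y‖ ^ (-(2 : ℝ))) * (ENNReal.ofReal (‖y‖ / 2) ^ (4 : ℝ))⁻¹
      ≤ ∫⁻ y in (ball (0 : EuclideanSpace ℝ (Fin 3)) 4)ᶜ,
          ENNReal.ofReal 1024 * ENNReal.ofReal ((1 + ‖y‖) ^ (-(6 : ℝ))) := by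
        refine setLIntegral_mono' measurableSet_ball.compl fun y hy => ?_
        have ht : 4 ≤ ‖y‖ := by simpa [mem_ball_zero_iff] using hy
        have hpos : 0 < (‖y‖ / 2) ^ (4 : ℝ) := Real.rpow_pos_of_pos (by linarith) _
        rw [ENNReal.ofReal_rpow_of_nonneg (by linarith) (by norm_num), ← ENNReal.ofReal_inv_of_pos hpos,
          ← ENNReal.ofReal_mul (Real.rpow_nonneg (norm_nonneg _) _), ← ENNReal.ofReal_mul (by norm_num)]
        exact ENNReal.ofReal_le_ofReal (far_weight_real ht)
    _ ≤ ∫⁻ y, ENNReal.ofReal 1024 * ENNReal.ofReal ((1 + ‖y‖) ^ (-(6 : ℝ))) :=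
        setLIntegral_le_lintegral _ _
    _ = ENNReal.ofReal 1024 * ∫⁻ y, ENNReal.ofReal ((1 + ‖y‖) ^ (-(6 : ℝ))) :=
        lintegral_const_mul' _ _ ENNReal.ofReal_ne_top

/-! ### The weight term under scale-invariant decay -/

variable {F : Type*} [NormedAddCommGroup F] [NormedSpace ℝ F]

omit [NormedSpace ℝ F] in
/-- **The cut-off weight term under the decay `‖y‖ ‖f y‖ ≤ D`** (Di Nezza–Palatucci–Valdinoci, Lemma 5.3 with
the far-field estimate of the proof of Lemma 5.1, `(n,s,p) = (3,½,2)`): for the cut-off `ψ` of `exists_cutoff`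
there is `K < ∞` with `∫ ‖f y‖² (∫ |ψ x − ψ y|²/‖x−y‖⁴ dx) dy ≤ D² K` for every `f` with `‖y‖‖f y‖ ≤ D`
(`K = C_W ∫_{B₄}‖y‖⁻² + |B̄₂| ∫_{‖y‖≥4} ‖y‖⁻²(‖y‖/2)⁻⁴`).
[cite: DinezzaPalatucciValdinoci2012, Lemma 5.3 and proof of Lemma 5.1] -/
private theorem exists_cutoff_weight_le :
    ∃ K : ℝ≥0∞, K ≠ ⊤ ∧ ∃ ψ : EuclideanSpace ℝ (Fin 3) → ℝ,
      (∀ x, 0 ≤ ψ x ∧ ψ x ≤ 1) ∧ (∀ x, ‖x‖ < 1 → ψ x = 1) ∧ (∀ x, 2 ≤ ‖x‖ → ψ x = 0) ∧ Continuous ψ ∧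
      ∀ (D : ℝ) (f : EuclideanSpace ℝ (Fin 3) → F), (∀ x, ‖x‖ * ‖f x‖ ≤ D) →
        ∫⁻ y, ‖f y‖ₑ ^ (2 : ℝ) * ∫⁻ x, ‖ψ x - ψ y‖ₑ ^ (2 : ℝ) / ‖x - y‖ₑ ^ (4 : ℝ) ≤
          ENNReal.ofReal (D ^ 2) * K := by
  obtain ⟨ψ, hψ01, hψ1, hψ0, hψL⟩ := exists_cutoff (E := EuclideanSpace ℝ (Fin 3))
  have hψabs : ∀ x, |ψ x| ≤ 1 := fun x => by rw [abs_of_nonneg (hψ01 x).1]; exact (hψ01 x).2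
  have hn3 : Module.finrank ℝ (EuclideanSpace ℝ (Fin 3)) = 3 := by simp
  -- Lemma 5.3: the weight is bounded
  obtain ⟨CW, hCW, hW⟩ := exists_lintegral_lipschitzWeight_le
    (volume : Measure (EuclideanSpace ℝ (Fin 3))) (by rw [hn3]; norm_num)
    (s := 1 / 2) (p := 2) (by norm_num) (by norm_num) (by norm_num) hψL hψabs
  have eN : ((Module.finrank ℝ (EuclideanSpace ℝ (Fin 3)) : ℝ) + 1 / 2 * 2) = 4 := by rw [hn3]; norm_num
  rw [eN] at hW
  -- proof of Lemma 5.1: the far-field bound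
  have hfar : ∀ y : EuclideanSpace ℝ (Fin 3), 4 ≤ ‖y‖ →
      ∫⁻ x, ‖ψ x - ψ y‖ₑ ^ (2 : ℝ) / ‖x - y‖ₑ ^ (4 : ℝ) ≤
        (ENNReal.ofReal (‖y‖ / 2) ^ (4 : ℝ))⁻¹ * volume (closedBall (0 : EuclideanSpace ℝ (Fin 3)) 2) := by
    intro y hy
    have hy' : 2 * 2 ≤ ‖y‖ := by linarith
    have h := lintegral_cutoffWeight_le_of_support (volume : Measure (EuclideanSpace ℝ (Fin 3)))
      two_pos hψabs (fun x hx => hψ0 x hx.le) (p := 2) two_pos (N := 4) (by norm_num) hy'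
    simpa only [Real.one_rpow, ENNReal.ofReal_one, one_mul] using h
  -- the two absorbing integrals
  have hInear := lintegral_ball_rpow_neg_two_lt_top 4
  have hIfar := lintegral_far_weight_lt_top
  have hV : volume (closedBall (0 : EuclideanSpace ℝ (Fin 3)) 2) < ⊤ := measure_closedBall_lt_top
  refine ⟨(∫⁻ y in ball (0 : EuclideanSpace ℝ (Fin 3)) 4, ENNReal.ofReal (‖y‖ ^ (-(2 : ℝ)))) * CW +
      (∫⁻ y in (ball (0 : EuclideanSpace ℝ (Fin 3)) 4)ᶜ,
        ENNReal.ofReal (‖y‖ ^ (-(2 : ℝ))) * (ENNReal.ofReal (‖y‖ / 2) ^ (4 : ℝ))⁻¹) *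
        volume (closedBall (0 : EuclideanSpace ℝ (Fin 3)) 2),
    ENNReal.add_ne_top.2 ⟨ENNReal.mul_ne_top hInear.ne hCW, ENNReal.mul_ne_top hIfar.ne hV.ne⟩,
    ψ, hψ01, hψ1, hψ0, hψL.continuous, fun D f hD => ?_⟩
  -- the majorant `w` of `‖f y‖² W(y) / D²`, valid for `y ≠ 0`
  have hpt : ∀ y : EuclideanSpace ℝ (Fin 3), y ≠ 0 →
      ‖f y‖ₑ ^ (2 : ℝ) * ∫⁻ x, ‖ψ x - ψ y‖ₑ ^ (2 : ℝ) / ‖x - y‖ₑ ^ (4 : ℝ) ≤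
        ENNReal.ofReal (D ^ 2) *
          ((ball (0 : EuclideanSpace ℝ (Fin 3)) 4).indicator
              (fun y => ENNReal.ofReal (‖y‖ ^ (-(2 : ℝ))) * CW) y +
            (ball (0 : EuclideanSpace ℝ (Fin 3)) 4)ᶜ.indicator
              (fun y => ENNReal.ofReal (‖y‖ ^ (-(2 : ℝ))) * (ENNReal.ofReal (‖y‖ / 2) ^ (4 : ℝ))⁻¹ *
                volume (closedBall (0 : EuclideanSpace ℝ (Fin 3)) 2)) y) := by
    intro y hy
    have hy0 : 0 < ‖y‖ := norm_pos_iff.2 hy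
    have hfy : ‖f y‖ ≤ D / ‖y‖ := by rw [le_div_iff₀ hy0, mul_comm]; exact hD y
    have hfy2 : ‖f y‖ₑ ^ (2 : ℝ) ≤ ENNReal.ofReal (D ^ 2) * ENNReal.ofReal (‖y‖ ^ (-(2 : ℝ))) := by
      rw [← ofReal_norm, ENNReal.ofReal_rpow_of_nonneg (norm_nonneg _) (by norm_num),
        ← ENNReal.ofReal_mul (sq_nonneg _), Real.rpow_two, Real.rpow_neg hy0.le, Real.rpow_two]
      refine ENNReal.ofReal_le_ofReal ?_
      calc ‖f y‖ ^ 2 ≤ (D / ‖y‖) ^ 2 := pow_le_pow_left₀ (norm_nonneg _) hfy 2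
        _ = D ^ 2 * (‖y‖ ^ 2)⁻¹ := by rw [div_pow, div_eq_mul_inv]
    by_cases hy4 : y ∈ ball (0 : EuclideanSpace ℝ (Fin 3)) 4
    · rw [indicator_of_mem hy4, indicator_of_notMem (notMem_compl_iff.2 hy4), add_zero, ← mul_assoc]
      exact mul_le_mul' hfy2 (hW y)
    · rw [indicator_of_notMem hy4, indicator_of_mem (mem_compl hy4), zero_add,
        mul_assoc (ENNReal.ofReal (‖y‖ ^ (-(2 : ℝ)))), ← mul_assoc (ENNReal.ofReal (D ^ 2))]
      rw [mem_ball_zero_iff, not_lt] at hy4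
      exact mul_le_mul' hfy2 (hfar y hy4)
  have hae : ∀ᵐ y ∂(volume : Measure (EuclideanSpace ℝ (Fin 3))), y ≠ 0 := by
    filter_upwards [compl_mem_ae_iff.2 (measure_singleton (0 : EuclideanSpace ℝ (Fin 3)))] with y hy
    simpa using hy
  have hmeas : Measurable fun y : EuclideanSpace ℝ (Fin 3) =>
      (ball (0 : EuclideanSpace ℝ (Fin 3)) 4).indicator (fun y => ENNReal.ofReal (‖y‖ ^ (-(2 : ℝ))) * CW) y :=
    (by fun_prop : Measurable fun y : EuclideanSpace ℝ (Fin 3) => ENNReal.ofReal (‖y‖ ^ (-(2 : ℝ))) * CW).indicator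
      measurableSet_ball
  calc ∫⁻ y, ‖f y‖ₑ ^ (2 : ℝ) * ∫⁻ x, ‖ψ x - ψ y‖ₑ ^ (2 : ℝ) / ‖x - y‖ₑ ^ (4 : ℝ)
      ≤ ∫⁻ y, ENNReal.ofReal (D ^ 2) *
          ((ball (0 : EuclideanSpace ℝ (Fin 3)) 4).indicator
              (fun y => ENNReal.ofReal (‖y‖ ^ (-(2 : ℝ))) * CW) y +
            (ball (0 : EuclideanSpace ℝ (Fin 3)) 4)ᶜ.indicator
              (fun y => ENNReal.ofReal (‖y‖ ^ (-(2 : ℝ))) * (ENNReal.ofReal (‖y‖ / 2) ^ (4 : ℝ))⁻¹ *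
                volume (closedBall (0 : EuclideanSpace ℝ (Fin 3)) 2)) y) :=
        lintegral_mono_ae (hae.mono hpt)
    _ = ENNReal.ofReal (D ^ 2) *
          ((∫⁻ y in ball (0 : EuclideanSpace ℝ (Fin 3)) 4, ENNReal.ofReal (‖y‖ ^ (-(2 : ℝ)))) * CW +
            (∫⁻ y in (ball (0 : EuclideanSpace ℝ (Fin 3)) 4)ᶜ,
              ENNReal.ofReal (‖y‖ ^ (-(2 : ℝ))) * (ENNReal.ofReal (‖y‖ / 2) ^ (4 : ℝ))⁻¹) *
              volume (closedBall (0 : EuclideanSpace ℝ (Fin 3)) 2)) := by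
        rw [lintegral_const_mul' _ _ ENNReal.ofReal_ne_top, lintegral_add_left hmeas,
          lintegral_indicator measurableSet_ball, lintegral_indicator measurableSet_ball.compl,
          lintegral_mul_const' _ _ hCW, lintegral_mul_const' _ _ hV.ne]

/-! ### The localised bound -/

/-- **Localised Theorem 6.5 on `ℝ³` under scale-invariant decay** (Di Nezza–Palatucci–Valdinoci 2012, Thm 6.5
for `(n,s,p) = (3,½,2)`, localised by Lemma 5.3 and the far-field estimate of Lemma 5.1): there is `C < ∞` such
that for every `D : ℝ` and every a.e.-strongly measurable `f : ℝ³ → F` with `‖x‖ ‖f x‖ ≤ D` for all `x`,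
`(∫_{B₁} ‖f‖³)^{2/3} ≤ C ∫_{x ∈ B₂} ∫ ‖f x − f y‖² / ‖x − y‖⁴ dy dx + C D²`.
[cite: DinezzaPalatucciValdinoci2012, Theorem 6.5 with Lemma 5.3 (localisation)] -/
theorem exists_lintegral_ball_cube_le_of_decay_R3 :
    ∃ C : ℝ≥0∞, C ≠ ⊤ ∧ ∀ (D : ℝ) (f : EuclideanSpace ℝ (Fin 3) → F), AEStronglyMeasurable f volume →
      (∀ x, ‖x‖ * ‖f x‖ ≤ D) →
      (∫⁻ x in ball (0 : EuclideanSpace ℝ (Fin 3)) 1, ‖f x‖ₑ ^ (3 : ℝ)) ^ ((2 : ℝ) / 3) ≤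
        C * (∫⁻ x in ball (0 : EuclideanSpace ℝ (Fin 3)) 2, ∫⁻ y, ‖f x - f y‖ₑ ^ (2 : ℝ) / ‖x - y‖ₑ ^ (4 : ℝ)) +
          C * ENNReal.ofReal (D ^ 2) := by
  obtain ⟨C₁, hC₁, h65⟩ := exists_lintegral_cube_le_mul_gagliardo_R3 (F := F)
  obtain ⟨K, hK, ψ, hψ01, hψ1, hψ0, hψc, hKf⟩ := exists_cutoff_weight_le (F := F)
  have hψabs : ∀ x, |ψ x| ≤ 1 := fun x => by rw [abs_of_nonneg (hψ01 x).1]; exact (hψ01 x).2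
  have hψm : AEMeasurable ψ volume := hψc.measurable.aemeasurable
  refine ⟨2 * C₁ * (1 + K), ENNReal.mul_ne_top (ENNReal.mul_ne_top ENNReal.ofNat_ne_top hC₁)
    (ENNReal.add_ne_top.2 ⟨ENNReal.one_ne_top, hK⟩), fun D f hf hD => ?_⟩
  -- `g = ψ f`: measurable, supported in `B₂`, `= f` on `B₁`
  have hgm : AEStronglyMeasurable (fun x => ψ x • f x) volume := hψc.aestronglyMeasurable.smul hf
  have hgsupp : (Function.support fun x => ψ x • f x) ⊆ ball 0 2 := by
    intro x hx
    rw [mem_ball_zero_iff]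
    by_contra h
    exact hx (by simp only [hψ0 x (not_lt.mp h), zero_smul])
  have hgvol : volume (Function.support fun x => ψ x • f x) ≠ ⊤ :=
    (lt_of_le_of_lt (measure_mono hgsupp) measure_ball_lt_top).ne
  have h1 : ∫⁻ x in ball (0 : EuclideanSpace ℝ (Fin 3)) 1, ‖f x‖ₑ ^ (3 : ℝ) ≤ ∫⁻ x, ‖ψ x • f x‖ₑ ^ (3 : ℝ) := by
    calc ∫⁻ x in ball (0 : EuclideanSpace ℝ (Fin 3)) 1, ‖f x‖ₑ ^ (3 : ℝ)
        = ∫⁻ x in ball (0 : EuclideanSpace ℝ (Fin 3)) 1, ‖ψ x • f x‖ₑ ^ (3 : ℝ) := by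
          refine setLIntegral_congr_fun measurableSet_ball fun x hx => ?_
          simp only [hψ1 x (mem_ball_zero_iff.mp hx), one_smul]
      _ ≤ ∫⁻ x, ‖ψ x • f x‖ₑ ^ (3 : ℝ) := setLIntegral_le_lintegral _ _
  -- Theorem 6.5 for `g`
  have h2 : (∫⁻ x, ‖ψ x • f x‖ₑ ^ (3 : ℝ)) ^ ((2 : ℝ) / 3) ≤
      C₁ * ∫⁻ x, ∫⁻ y, ‖ψ x • f x - ψ y • f y‖ₑ ^ (2 : ℝ) / ‖x - y‖ₑ ^ (4 : ℝ) :=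
    h65 (fun x => ψ x • f x) hgm hgvol
  -- Lemma 5.3: the split
  have h3 := lintegral_gagliardo_smul_le (μ := (volume : Measure (EuclideanSpace ℝ (Fin 3)))) 4 (p := 2)
    one_le_two hψm hf
  have e21 : (2 : ℝ≥0∞) ^ ((2 : ℝ) - 1) = 2 := by
    rw [show (2 : ℝ) - 1 = 1 by norm_num, ENNReal.rpow_one]
  rw [e21] at h3
  -- first piece: lives on `x ∈ B₂`, and `|ψ|² ≤ 1`
  have h4 : ∫⁻ x, ∫⁻ y, ‖ψ x‖ₑ ^ (2 : ℝ) * (‖f x - f y‖ₑ ^ (2 : ℝ) / ‖x - y‖ₑ ^ (4 : ℝ)) ≤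
      ∫⁻ x in ball (0 : EuclideanSpace ℝ (Fin 3)) 2, ∫⁻ y, ‖f x - f y‖ₑ ^ (2 : ℝ) / ‖x - y‖ₑ ^ (4 : ℝ) := by
    have hs : (Function.support fun x : EuclideanSpace ℝ (Fin 3) =>
        ∫⁻ y, ‖ψ x‖ₑ ^ (2 : ℝ) * (‖f x - f y‖ₑ ^ (2 : ℝ) / ‖x - y‖ₑ ^ (4 : ℝ))) ⊆ ball 0 2 := by
      intro x hx
      rw [mem_ball_zero_iff]
      by_contra h
      refine Function.mem_support.mp hx ?_
      simp only [hψ0 x (not_lt.mp h), enorm_zero, ENNReal.zero_rpow_of_pos (by norm_num : (0 : ℝ) < 2),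
        zero_mul, lintegral_zero]
    calc ∫⁻ x, ∫⁻ y, ‖ψ x‖ₑ ^ (2 : ℝ) * (‖f x - f y‖ₑ ^ (2 : ℝ) / ‖x - y‖ₑ ^ (4 : ℝ))
        = ∫⁻ x in ball (0 : EuclideanSpace ℝ (Fin 3)) 2,
            ∫⁻ y, ‖ψ x‖ₑ ^ (2 : ℝ) * (‖f x - f y‖ₑ ^ (2 : ℝ) / ‖x - y‖ₑ ^ (4 : ℝ)) :=
          (setLIntegral_eq_of_support_subset hs).symm
      _ ≤ ∫⁻ x in ball (0 : EuclideanSpace ℝ (Fin 3)) 2, ∫⁻ y, ‖f x - f y‖ₑ ^ (2 : ℝ) / ‖x - y‖ₑ ^ (4 : ℝ) := by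
          refine lintegral_mono fun x => ?_
          rw [lintegral_const_mul' _ _ (ENNReal.rpow_ne_top_of_nonneg (by norm_num) enorm_ne_top)]
          refine mul_le_of_le_one_left' (ENNReal.rpow_le_one ?_ (by norm_num))
          rw [Real.enorm_eq_ofReal_abs]
          exact ENNReal.ofReal_le_one.2 (hψabs x)
  -- second piece: the weight term under the decay
  have h5 := hKf D f hD
  -- assemble
  calc (∫⁻ x in ball (0 : EuclideanSpace ℝ (Fin 3)) 1, ‖f x‖ₑ ^ (3 : ℝ)) ^ ((2 : ℝ) / 3)
      ≤ (∫⁻ x, ‖ψ x • f x‖ₑ ^ (3 : ℝ)) ^ ((2 : ℝ) / 3) := ENNReal.rpow_le_rpow h1 (by norm_num)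
    _ ≤ C₁ * ∫⁻ x, ∫⁻ y, ‖ψ x • f x - ψ y • f y‖ₑ ^ (2 : ℝ) / ‖x - y‖ₑ ^ (4 : ℝ) := h2
    _ ≤ C₁ * (2 * ((∫⁻ x in ball (0 : EuclideanSpace ℝ (Fin 3)) 2,
          ∫⁻ y, ‖f x - f y‖ₑ ^ (2 : ℝ) / ‖x - y‖ₑ ^ (4 : ℝ)) + ENNReal.ofReal (D ^ 2) * K)) :=
        mul_le_mul' le_rfl (h3.trans (mul_le_mul' le_rfl (add_le_add h4 h5)))
    _ = 2 * C₁ * (∫⁻ x in ball (0 : EuclideanSpace ℝ (Fin 3)) 2,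
          ∫⁻ y, ‖f x - f y‖ₑ ^ (2 : ℝ) / ‖x - y‖ₑ ^ (4 : ℝ)) + 2 * C₁ * K * ENNReal.ofReal (D ^ 2) := by
        ring
    _ ≤ 2 * C₁ * (1 + K) * (∫⁻ x in ball (0 : EuclideanSpace ℝ (Fin 3)) 2,
          ∫⁻ y, ‖f x - f y‖ₑ ^ (2 : ℝ) / ‖x - y‖ₑ ^ (4 : ℝ)) +
        2 * C₁ * (1 + K) * ENNReal.ofReal (D ^ 2) := by
        have e1 : 2 * C₁ * (1 + K) * (∫⁻ x in ball (0 : EuclideanSpace ℝ (Fin 3)) 2,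
            ∫⁻ y, ‖f x - f y‖ₑ ^ (2 : ℝ) / ‖x - y‖ₑ ^ (4 : ℝ)) =
            2 * C₁ * (∫⁻ x in ball (0 : EuclideanSpace ℝ (Fin 3)) 2,
              ∫⁻ y, ‖f x - f y‖ₑ ^ (2 : ℝ) / ‖x - y‖ₑ ^ (4 : ℝ)) +
            2 * C₁ * K * (∫⁻ x in ball (0 : EuclideanSpace ℝ (Fin 3)) 2,
              ∫⁻ y, ‖f x - f y‖ₑ ^ (2 : ℝ) / ‖x - y‖ₑ ^ (4 : ℝ)) := by ring
        have e2 : 2 * C₁ * (1 + K) * ENNReal.ofReal (D ^ 2) =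
            2 * C₁ * K * ENNReal.ofReal (D ^ 2) + 2 * C₁ * ENNReal.ofReal (D ^ 2) := by ring
        rw [e1, e2]
        exact add_le_add le_self_add le_self_add

/-- **Localised Theorem 6.5 on `ℝ³` under scale-invariant decay, `L³(B₁)`-mass form**: with the constant `C` of
`exists_lintegral_ball_cube_le_of_decay_R3`,
`∫_{B₁} ‖f‖³ ≤ (C ∫_{x∈B₂}∫ ‖f x − f y‖²/‖x−y‖⁴ + C D²)^{3/2}` (natural-number cube on the left).
[cite: DinezzaPalatucciValdinoci2012, Theorem 6.5 with Lemma 5.3 (localisation)] -/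
theorem exists_lintegral_ball_cube_le_rpow_of_decay_R3 :
    ∃ C : ℝ≥0∞, C ≠ ⊤ ∧ ∀ (D : ℝ) (f : EuclideanSpace ℝ (Fin 3) → F), AEStronglyMeasurable f volume →
      (∀ x, ‖x‖ * ‖f x‖ ≤ D) →
      ∫⁻ x in ball (0 : EuclideanSpace ℝ (Fin 3)) 1, ‖f x‖ₑ ^ 3 ≤
        (C * (∫⁻ x in ball (0 : EuclideanSpace ℝ (Fin 3)) 2, ∫⁻ y, ‖f x - f y‖ₑ ^ (2 : ℝ) / ‖x - y‖ₑ ^ (4 : ℝ)) +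
          C * ENNReal.ofReal (D ^ 2)) ^ ((3 : ℝ) / 2) := by
  obtain ⟨C, hC, h⟩ := exists_lintegral_ball_cube_le_of_decay_R3 (F := F)
  refine ⟨C, hC, fun D f hf hD => ?_⟩
  have h' := ENNReal.rpow_le_rpow (h D f hf hD) (by norm_num : (0 : ℝ) ≤ 3 / 2)
  rw [← ENNReal.rpow_mul, show (2 : ℝ) / 3 * (3 / 2) = 1 by norm_num, ENNReal.rpow_one] at h'
  have e : ∀ x : EuclideanSpace ℝ (Fin 3), ‖f x‖ₑ ^ 3 = ‖f x‖ₑ ^ (3 : ℝ) := fun x => by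
    rw [← ENNReal.rpow_natCast]; norm_num
  simp_rw [e]
  exact h'

end DiNezzaPalatucciValdinoci2012

end Literature.Analysis.FunctionSpaces
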